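import Mathlib
import Summits.AtomisticToContinuum.HydrodynamicLimit.Theorems.ImplosionDichotomyDenseExcursionCavityResFuchsUniform

/-!
# Uniqueness of the smooth branch of a first-kind singular system from finitely many jets — at and off the resonances
# (crux `DenseExcursion`, line `sonic-cavity-renewal`, brick for stub `stub_cavityResolventCk`, theorem T7(i) (β′))

Helper file (`--supports stmt-AtomisticToContinuum-12586`, line lead a2, stub-worker E2 for `stub_cavityResolventCk`).
For the first-kind singular system with a vector-valued regular row (`…CavityResDescent`)

  `R·u′ = a₁₁ u + a₁₂(c) + b₁`,   `c′ = a₂₁(u) + a₂₂(c) + b₂`,   `Re a₁₁(0) ≤ M − 1`,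

two `C^∞` solutions on some `(−δ′, δ′)` COINCIDE NEAR `0` as soon as they have the same `c(0)` and the same jet
`(u(0), u′(0), …, u⁽ᴹ⁻¹⁾(0))` (`res_branch_unique`, registered), and — if moreover `a₁₁(0) ∉ {0, 1, …, M − 1}` (no jet
resonance) — as soon as they have the same `c(0)` (`res_branch_unique_offjets`, registered). NO GAP QUANTIFICATION, NO POWER
`x^ν`: a smooth solution differentiates to a smooth solution of the derived system (`derive_solution`, converse of
`lift_solution`), `M` times down to exponent `Re ≤ −1`, where the a priori bound of `res_fuchs_uniform` (with the bounds of
the given coefficients on `[−1, 1]`, which exist by compactness) forces the difference to vanish; off the resonances the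
constraint `a₁₁(0)u(0) + a₁₂(0)c(0) + b₁(0) = 0` (the singular row at `R = 0`) propagates `c(0)`-agreement to `u(0)`-agreement
level by level. This is the resonance-proof replacement of (β′) `singular_branch_unique_gap` of the T7(i) plan: together
with regular uniqueness off the sonic point it identifies the canonical local branches for EVERY `Λ` of the region.
Sources: folklore (Coddington–Levinson 1955 Ch. 4).
-/

noncomputable section

open Set Filter
open scoped Topology ContDiff

namespace Summit.AtomisticToContinuum.HydrodynamicLimit.Theorems.SonicCavityRenewal

/-! ## A smooth solution differentiates to a solution of the derived system -/

/-- **DERIVING A SOLUTION** (converse of `lift_solution`): if `(u, c)` is a `C^∞` solution of the system on `(−δ, δ)` then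
`U = u′`, `v = (u, c)` is a `C^∞` solution of the derived system of `derived_coefficients` there. [folklore] -/
theorem derive_solution {E : Type*} [NormedAddCommGroup E] [NormedSpace ℂ E] {a₁₁ b₁ u : ℝ → ℂ} {a₁₂ : ℝ → E →L[ℂ] ℂ}
    {a₂₁ : ℝ → ℂ →L[ℂ] E} {a₂₂ : ℝ → E →L[ℂ] E} {b₂ c : ℝ → E} {A₁₂ : ℝ → (ℂ × E) →L[ℂ] ℂ}
    {A₂₂ : ℝ → (ℂ × E) →L[ℂ] (ℂ × E)} {δ : ℝ} (ha₁₁ : ContDiff ℝ ∞ a₁₁) (ha₁₂ : ContDiff ℝ ∞ a₁₂)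
    (hb₁ : ContDiff ℝ ∞ b₁)
    (hA₁₂ : ∀ (R : ℝ) (w : ℂ × E), A₁₂ R w = deriv a₁₁ R * w.1 + a₁₂ R (a₂₁ R w.1 + a₂₂ R w.2) + deriv a₁₂ R w.2)
    (hA₂₂ : ∀ (R : ℝ) (w : ℂ × E), A₂₂ R w = (0, a₂₁ R w.1 + a₂₂ R w.2))
    (hu : ContDiffOn ℝ ∞ u (Ioo (-δ) δ)) (hc : ContDiffOn ℝ ∞ c (Ioo (-δ) δ))
    (hsol : ∀ R ∈ Ioo (-δ) δ, (R : ℂ) * deriv u R = a₁₁ R * u R + a₁₂ R (c R) + b₁ R ∧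
      deriv c R = a₂₁ R (u R) + a₂₂ R (c R) + b₂ R) :
    ContDiffOn ℝ ∞ (deriv u) (Ioo (-δ) δ) ∧ ContDiffOn ℝ ∞ (fun R => (u R, c R)) (Ioo (-δ) δ) ∧
      ∀ R ∈ Ioo (-δ) δ, (R : ℂ) * deriv (deriv u) R =
          (a₁₁ R - 1) * deriv u R + A₁₂ R (u R, c R) + (a₁₂ R (b₂ R) + deriv b₁ R) ∧
        deriv (fun R => (u R, c R)) R = (ContinuousLinearMap.inl ℂ ℂ E) (deriv u R) + A₂₂ R (u R, c R) + ((0 : ℂ), b₂ R) := by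
  have hO : IsOpen (Ioo (-δ) δ) := isOpen_Ioo
  have hu' : ContDiffOn ℝ ∞ (deriv u) (Ioo (-δ) δ) := ((contDiffOn_infty_iff_deriv_of_isOpen hO).1 hu).2
  have hdf : ∀ {φ : ℝ → ℂ}, ContDiffOn ℝ ∞ φ (Ioo (-δ) δ) → ∀ y ∈ Ioo (-δ) δ, HasDerivAt φ (deriv φ y) y :=
    fun hφ y hy => ((hφ.differentiableOn (by simp)) y hy |>.differentiableAt (hO.mem_nhds hy)).hasDerivAt
  have hdfE : ∀ {φ : ℝ → E}, ContDiffOn ℝ ∞ φ (Ioo (-δ) δ) → ∀ y ∈ Ioo (-δ) δ, HasDerivAt φ (deriv φ y) y :=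
    fun hφ y hy => ((hφ.differentiableOn (by simp)) y hy |>.differentiableAt (hO.mem_nhds hy)).hasDerivAt
  have hdg : ∀ {φ : ℝ → ℂ}, ContDiff ℝ ∞ φ → ∀ y, HasDerivAt φ (deriv φ y) y :=
    fun hφ y => (hφ.differentiable (by simp) y).hasDerivAt
  have hdgL : ∀ {φ : ℝ → E →L[ℂ] ℂ}, ContDiff ℝ ∞ φ → ∀ y, HasDerivAt φ (deriv φ y) y :=
    fun hφ y => (hφ.differentiable (by simp) y).hasDerivAt
  refine ⟨hu', hu.prodMk hc, fun R hR => ⟨?_, ?_⟩⟩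
  · -- differentiate the singular row
    have hev : (fun y => (y : ℂ) * deriv u y) =ᶠ[𝓝 R] fun y => a₁₁ y * u y + a₁₂ y (c y) + b₁ y := by
      filter_upwards [hO.mem_nhds hR] with y hy
      exact (hsol y hy).1
    have d1 : HasDerivAt (fun y : ℝ => (y : ℂ) * deriv u y) (1 * deriv u R + (R : ℂ) * deriv (deriv u) R) R := by
      have h := (hasDerivAt_id R).ofReal_comp
      simp only [id, Complex.ofReal_one] at h
      exact h.mul (hdf hu' R hR)
    have d2 : HasDerivAt (fun y => a₁₁ y * u y + a₁₂ y (c y) + b₁ y)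
        (deriv a₁₁ R * u R + a₁₁ R * deriv u R + (a₁₂ R (deriv c R) + deriv a₁₂ R (c R)) + deriv b₁ R) R :=
      (((hdg ha₁₁ R).mul (hdf hu R hR)).add (hasDerivAt_clm_apply_real (hdgL ha₁₂ R) (hdfE hc R hR))).add (hdg hb₁ R)
    have key : 1 * deriv u R + (R : ℂ) * deriv (deriv u) R =
        deriv a₁₁ R * u R + a₁₁ R * deriv u R + (a₁₂ R (deriv c R) + deriv a₁₂ R (c R)) + deriv b₁ R := by
      rw [← d1.deriv, ← d2.deriv]; exact hev.deriv_eq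
    rw [hA₁₂, (hsol R hR).2] at *
    simp only [map_add] at key ⊢
    linear_combination key
  · -- the regular row
    have d : HasDerivAt (fun y => (u y, c y)) (deriv u R, deriv c R) R := (hdf hu R hR).prodMk (hdfE hc R hR)
    rw [d.deriv, (hsol R hR).2, hA₂₂]
    ext <;> simp

/-! ## Uniqueness from `c(0)` and the `M`-jet of `u` -/

/-- **Registered helper `res_branch_unique`: UNIQUENESS OF THE SMOOTH BRANCH FROM FINITELY MANY JETS, FOR EVERY
EXPONENT WITH `Re a₁₁(0) ≤ M − 1`.** Two `C^∞` solutions on `(−δ′, δ′)` with the same `c(0)` and the same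
`u⁽ʲ⁾(0)`, `j < M`, coincide on some `(−δ″, δ″)`. [folklore] -/
theorem res_branch_unique : ∀ (M : ℕ) (E : Type) [NormedAddCommGroup E] [NormedSpace ℂ E] [CompleteSpace E] (a₁₁ : ℝ → ℂ) (a₁₂ : ℝ → E →L[ℂ] ℂ) (a₂₁ : ℝ → ℂ →L[ℂ] E) (a₂₂ : ℝ → E →L[ℂ] E), ContDiff ℝ ∞ a₁₁ → ContDiff ℝ ∞ a₁₂ → ContDiff ℝ ∞ a₂₁ → ContDiff ℝ ∞ a₂₂ → (a₁₁ 0).re ≤ (M : ℝ) - 1 → ∀ (b₁ : ℝ → ℂ) (b₂ : ℝ → E), ContDiff ℝ ∞ b₁ → ContDiff ℝ ∞ b₂ → ∀ (u u' : ℝ → ℂ) (c c' : ℝ → E) (δ' : ℝ), 0 < δ' → ContDiffOn ℝ ∞ u (Set.Ioo (-δ') δ') → ContDiffOn ℝ ∞ c (Set.Ioo (-δ') δ') → ContDiffOn ℝ ∞ u' (Set.Ioo (-δ') δ') → ContDiffOn ℝ ∞ c' (Set.Ioo (-δ') δ') → (∀ R ∈ Set.Ioo (-δ') δ', (R : ℂ)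 * deriv u R = a₁₁ R * u R + a₁₂ R (c R) + b₁ R ∧ deriv c R = a₂₁ R (u R) + a₂₂ R (c R) + b₂ R) → (∀ R ∈ Set.Ioo (-δ') δ', (R : ℂ) * deriv u' R = a₁₁ R * u' R + a₁₂ R (c' R) + b₁ R ∧ deriv c' R = a₂₁ R (u' R) + a₂₂ R (c' R) + b₂ R) → c 0 = c' 0 → (∀ j : ℕ, j < M → iteratedDeriv j u 0 = iteratedDeriv j u' 0) → ∃ δ'' : ℝ, 0 < δ'' ∧ δ'' ≤ δ' ∧ ∀ R ∈ Set.Ioo (-δ'') δ'', u R = u' R ∧ c R = c' R := by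
  intro M
  induction M with
  | zero =>
    intro E _ _ _ a₁₁ a₁₂ a₂₁ a₂₂ ha₁₁ ha₁₂ ha₂₁ ha₂₂ hre b₁ b₂ hb₁ hb₂ u u' c c' δ' hδ' hu hc hu' hc' hsol hsol' hc0 _
    -- bounds of the coefficients on `[−1, 1]`, and the uniform radius for them
    have hK : IsCompact (Icc (-1 : ℝ) 1) := isCompact_Icc
    have ha₁₁' : ContDiff ℝ ∞ (deriv a₁₁) := (contDiff_infty_iff_deriv.1 ha₁₁).2
    obtain ⟨A₁, hA₁⟩ := hK.exists_bound_of_continuousOn ha₁₁'.continuous.continuousOn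
    obtain ⟨A, hA⟩ := hK.exists_bound_of_continuousOn ha₁₂.continuous.continuousOn
    obtain ⟨B, hB⟩ := hK.exists_bound_of_continuousOn ha₂₁.continuous.continuousOn
    obtain ⟨D, hD⟩ := hK.exists_bound_of_continuousOn ha₂₂.continuous.continuousOn
    have h0I : (0 : ℝ) ∈ Icc (-1 : ℝ) 1 := by norm_num
    obtain ⟨δ, hδ, -, K, -, hmain⟩ := res_fuchs_uniform E (max A₁ 0) (max A 0) (max B 0) (max D 0) (le_max_right _ _)
      (le_max_right _ _) (le_max_right _ _) (le_max_right _ _)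
    obtain ⟨-, hap⟩ := hmain (a₁₁ 0) a₁₁ a₁₂ a₂₁ a₂₂ (by simpa using hre) ha₁₁ ha₁₂ ha₂₁ ha₂₂ rfl
      (fun s hs => ⟨(hA₁ s hs).trans (le_max_left _ _), (hA s hs).trans (le_max_left _ _), (hB s hs).trans (le_max_left _ _),
        (hD s hs).trans (le_max_left _ _)⟩) (fun _ => 0) (fun _ => 0) contDiff_const contDiff_const
    -- the difference solves the system with zero sources and zero datum on `(−δ″, δ″)`
    set δ'' : ℝ := min δ δ' with hδ''
    have hδ''pos : 0 < δ'' := lt_min hδ hδ'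
    have hsub : Ioo (-δ'') δ'' ⊆ Ioo (-δ') δ' := Ioo_subset_Ioo (neg_le_neg (min_le_right _ _)) (min_le_right _ _)
    have hO : IsOpen (Ioo (-δ') δ') := isOpen_Ioo
    have hdf : ∀ {φ : ℝ → ℂ}, ContDiffOn ℝ ∞ φ (Ioo (-δ') δ') → ∀ y ∈ Ioo (-δ') δ', HasDerivAt φ (deriv φ y) y :=
      fun hφ y hy => ((hφ.differentiableOn (by simp)) y hy |>.differentiableAt (hO.mem_nhds hy)).hasDerivAt
    have hdfE : ∀ {φ : ℝ → E}, ContDiffOn ℝ ∞ φ (Ioo (-δ') δ') → ∀ y ∈ Ioo (-δ') δ', HasDerivAt φ (deriv φ y) y :=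
      fun hφ y hy => ((hφ.differentiableOn (by simp)) y hy |>.differentiableAt (hO.mem_nhds hy)).hasDerivAt
    have hle1 : ((1 : ℕ∞) : WithTop ℕ∞) ≤ ∞ := by exact_mod_cast le_top
    have hsold : ∀ R ∈ Ioo (-δ'') δ'', (R : ℂ) * deriv (fun y => u y - u' y) R =
        a₁₁ R * (u R - u' R) + a₁₂ R (c R - c' R) + (fun _ => (0 : ℂ)) R ∧
        deriv (fun y => c y - c' y) R = a₂₁ R (u R - u' R) + a₂₂ R (c R - c' R) + (fun _ => (0 : E)) R := by
      intro R hR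
      have hR' := hsub hR
      obtain ⟨e1, e2⟩ := hsol R hR'
      obtain ⟨f1, f2⟩ := hsol' R hR'
      rw [((hdf hu R hR').fun_sub (hdf hu' R hR')).deriv, ((hdfE hc R hR').fun_sub (hdfE hc' R hR')).deriv]
      simp only [map_sub]
      constructor
      · linear_combination e1 - f1
      · rw [e2, f2]; abel
    have key := hap (fun y => u y - u' y) (fun y => c y - c' y) δ'' hδ''pos (min_le_left _ _)
      ((hu.sub hu').mono hsub |>.of_le hle1) ((hc.sub hc').mono hsub |>.of_le hle1) hsold
    refine ⟨δ'', hδ''pos, min_le_right _ _, fun R hR => ?_⟩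
    obtain ⟨k1, k2⟩ := key |R| 0 (abs_nonneg R) (abs_lt.2 hR) (fun s _ => by simp) R ⟨neg_abs_le R, le_abs_self R⟩
    simp only [hc0, sub_self, norm_zero, zero_add, mul_zero] at k1 k2
    exact ⟨sub_eq_zero.1 (norm_le_zero_iff.1 k1), sub_eq_zero.1 (norm_le_zero_iff.1 k2)⟩
  | succ M ih =>
    intro E _ _ _ a₁₁ a₁₂ a₂₁ a₂₂ ha₁₁ ha₁₂ ha₂₁ ha₂₂ hre b₁ b₂ hb₁ hb₂ u u' c c' δ' hδ' hu hc hu' hc' hsol hsol' hc0 hjet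
    obtain ⟨A₁₂, A₂₂, hA₁₂s, hA₂₂s, hA₁₂, hA₂₂⟩ := derived_coefficients ha₁₁ ha₁₂ ha₂₁ ha₂₂
    obtain ⟨hU, hv, hder⟩ := derive_solution ha₁₁ ha₁₂ hb₁ hA₁₂ hA₂₂ hu hc hsol
    obtain ⟨hU', hv', hder'⟩ := derive_solution ha₁₁ ha₁₂ hb₁ hA₁₂ hA₂₂ hu' hc' hsol'
    have hb₁' : ContDiff ℝ ∞ (deriv b₁) := (contDiff_infty_iff_deriv.1 hb₁).2
    have hu0 : u 0 = u' 0 := by simpa using hjet 0 (Nat.succ_pos M)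
    have hre' : ((fun R => a₁₁ R - 1) 0).re ≤ (M : ℝ) - 1 := by
      simp only [Complex.sub_re, Complex.one_re]; push_cast at hre; linarith
    obtain ⟨δ'', hδ''pos, hδ''le, heq⟩ := ih (ℂ × E) (fun R => a₁₁ R - 1) A₁₂ (fun _ => ContinuousLinearMap.inl ℂ ℂ E) A₂₂
      (ha₁₁.sub contDiff_const) hA₁₂s contDiff_const hA₂₂s hre' (fun R => a₁₂ R (b₂ R) + deriv b₁ R)
      (fun R => ((0 : ℂ), b₂ R)) ((contDiff_clm_apply_real ha₁₂ hb₂).add hb₁') (contDiff_const.prodMk hb₂)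
      (deriv u) (deriv u') (fun R => (u R, c R)) (fun R => (u' R, c' R)) δ' hδ' hU hv hU' hv' hder hder'
      (by simp only [hu0, hc0]) (fun j hj => by
        have := hjet (j + 1) (by omega)
        rwa [iteratedDeriv_succ', iteratedDeriv_succ'] at this)
    refine ⟨δ'', hδ''pos, hδ''le, fun R hR => ?_⟩
    have h := (heq R hR).2
    simp only [Prod.mk.injEq] at h
    exact h

/-- **Registered helper `res_branch_unique_offjets`: UNIQUENESS OF THE SMOOTH BRANCH FROM `c(0)` OFF THE JET
RESONANCES.** If `Re a₁₁(0) ≤ M − 1` and `a₁₁(0) ≠ j` for `j < M`, two `C^∞` solutions on `(−δ′, δ′)` with the same `c(0)`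
coincide on some `(−δ″, δ″)`. [folklore] -/
theorem res_branch_unique_offjets : ∀ (M : ℕ) (E : Type) [NormedAddCommGroup E] [NormedSpace ℂ E] [CompleteSpace E] (a₁₁ : ℝ → ℂ) (a₁₂ : ℝ → E →L[ℂ] ℂ) (a₂₁ : ℝ → ℂ →L[ℂ] E) (a₂₂ : ℝ → E →L[ℂ] E), ContDiff ℝ ∞ a₁₁ → ContDiff ℝ ∞ a₁₂ → ContDiff ℝ ∞ a₂₁ → ContDiff ℝ ∞ a₂₂ → (a₁₁ 0).re ≤ (M : ℝ) - 1 → (∀ j : ℕ, j < M → a₁₁ 0 ≠ (j : ℂ)) → ∀ (b₁ : ℝ → ℂ) (b₂ : ℝ → E), ContDiff ℝ ∞ b₁ → ContDiff ℝ ∞ b₂ → ∀ (u u' : ℝ → ℂ) (c c' : ℝ → E) (δ' : ℝ), 0 < δ' → ContDiffOn ℝ ∞ u (Set.Ioo (-δ') δ') → ContDiffOn ℝ ∞ c (Set.Ioo (-δ') δ') → ContDiffOn ℝ ∞ u' (Set.Ioo (-δ') δ') → ContDiffOn ℝ ∞ c' (Set.Ioo (-δ') δ') → (∀ R ∈ Set.Ioo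 (-δ') δ', (R : ℂ) * deriv u R = a₁₁ R * u R + a₁₂ R (c R) + b₁ R ∧ deriv c R = a₂₁ R (u R) + a₂₂ R (c R) + b₂ R) → (∀ R ∈ Set.Ioo (-δ') δ', (R : ℂ) * deriv u' R = a₁₁ R * u' R + a₁₂ R (c' R) + b₁ R ∧ deriv c' R = a₂₁ R (u' R) + a₂₂ R (c' R) + b₂ R) → c 0 = c' 0 → ∃ δ'' : ℝ, 0 < δ'' ∧ δ'' ≤ δ' ∧ ∀ R ∈ Set.Ioo (-δ'') δ'', u R = u' R ∧ c R = c' R := by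
  intro M
  induction M with
  | zero =>
    intro E _ _ _ a₁₁ a₁₂ a₂₁ a₂₂ ha₁₁ ha₁₂ ha₂₁ ha₂₂ hre _ b₁ b₂ hb₁ hb₂ u u' c c' δ' hδ' hu hc hu' hc' hsol hsol' hc0
    exact res_branch_unique 0 E a₁₁ a₁₂ a₂₁ a₂₂ ha₁₁ ha₁₂ ha₂₁ ha₂₂ hre b₁ b₂ hb₁ hb₂ u u' c c' δ' hδ' hu hc hu' hc' hsol hsol'
      hc0 (fun j hj => absurd hj (Nat.not_lt_zero j))
  | succ M ih =>
    intro E _ _ _ a₁₁ a₁₂ a₂₁ a₂₂ ha₁₁ ha₁₂ ha₂₁ ha₂₂ hre hnr b₁ b₂ hb₁ hb₂ u u' c c' δ' hδ' hu hc hu' hc' hsol hsol' hc0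
    obtain ⟨A₁₂, A₂₂, hA₁₂s, hA₂₂s, hA₁₂, hA₂₂⟩ := derived_coefficients ha₁₁ ha₁₂ ha₂₁ ha₂₂
    obtain ⟨hU, hv, hder⟩ := derive_solution ha₁₁ ha₁₂ hb₁ hA₁₂ hA₂₂ hu hc hsol
    obtain ⟨hU', hv', hder'⟩ := derive_solution ha₁₁ ha₁₂ hb₁ hA₁₂ hA₂₂ hu' hc' hsol'
    have hb₁' : ContDiff ℝ ∞ (deriv b₁) := (contDiff_infty_iff_deriv.1 hb₁).2
    -- the singular row at `R = 0` determines `u(0)` since `a₁₁(0) ≠ 0`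
    have h0 : (0 : ℝ) ∈ Ioo (-δ') δ' := ⟨by linarith, hδ'⟩
    have hu0 : u 0 = u' 0 := by
      have e := (hsol 0 h0).1
      have f := (hsol' 0 h0).1
      simp only [Complex.ofReal_zero, zero_mul] at e f
      rw [hc0] at e
      have h : a₁₁ 0 * (u 0 - u' 0) = 0 := by linear_combination -e + f
      have ha0 : a₁₁ 0 ≠ 0 := by simpa using hnr 0 (Nat.succ_pos M)
      exact sub_eq_zero.1 ((mul_eq_zero.1 h).resolve_left ha0)
    have hre' : ((fun R => a₁₁ R - 1) 0).re ≤ (M : ℝ) - 1 := by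
      simp only [Complex.sub_re, Complex.one_re]; push_cast at hre; linarith
    have hnr' : ∀ j : ℕ, j < M → (fun R => a₁₁ R - 1) 0 ≠ (j : ℂ) := fun j hj h => by
      refine hnr (j + 1) (by omega) ?_
      simp only at h; push_cast; linear_combination h
    obtain ⟨δ'', hδ''pos, hδ''le, heq⟩ := ih (ℂ × E) (fun R => a₁₁ R - 1) A₁₂ (fun _ => ContinuousLinearMap.inl ℂ ℂ E) A₂₂
      (ha₁₁.sub contDiff_const) hA₁₂s contDiff_const hA₂₂s hre' hnr' (fun R => a₁₂ R (b₂ R) + deriv b₁ R)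
      (fun R => ((0 : ℂ), b₂ R)) ((contDiff_clm_apply_real ha₁₂ hb₂).add hb₁') (contDiff_const.prodMk hb₂)
      (deriv u) (deriv u') (fun R => (u R, c R)) (fun R => (u' R, c' R)) δ' hδ' hU hv hU' hv' hder hder'
      (by simp only [hu0, hc0])
    refine ⟨δ'', hδ''pos, hδ''le, fun R hR => ?_⟩
    have h := (heq R hR).2
    simp only [Prod.mk.injEq] at h
    exact h


/-! ## The scalar form -/

/-- **Registered helper `fuchs_branch_unique_offjets`: UNIQUENESS OF THE SMOOTH BRANCH OF THE SCALAR `2 × 2` SYSTEM FROM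
`c(0)` OFF THE JET RESONANCES.** For the scalar system `R u′ = a₁₁ u + a₁₂ c + b₁`, `c′ = a₂₁ u + a₂₂ c + b₂` with
`Re a₁₁(0) ≤ M − 1` and `a₁₁(0) ∉ {0, …, M − 1}`, two `C^∞` solutions on `(−δ′, δ′)` with the same `c(0)` coincide on some
`(−δ″, δ″)`. [folklore] -/
theorem fuchs_branch_unique_offjets : ∀ (M : ℕ) (a₁₁ a₁₂ a₂₁ a₂₂ : ℝ → ℂ), ContDiff ℝ ∞ a₁₁ → ContDiff ℝ ∞ a₁₂ → ContDiff ℝ ∞ a₂₁ → ContDiff ℝ ∞ a₂₂ → (a₁₁ 0).re ≤ (M : ℝ) - 1 → (∀ j : ℕ, j < M → a₁₁ 0 ≠ (j : ℂ)) → ∀ (b₁ b₂ : ℝ → ℂ), ContDiff ℝ ∞ b₁ → ContDiff ℝ ∞ b₂ → ∀ (u u' c c' : ℝ → ℂ) (δ' : ℝ), 0 < δ' → ContDiffOn ℝ ∞ u (Set.Ioo (-δ') δ') → ContDiffOn ℝ ∞ c (Set.Ioo (-δ') δ') → ContDiffOn ℝ ∞ u' (Set.Ioo (-δ') δ') → ContDiffOn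 ℝ ∞ c' (Set.Ioo (-δ') δ') → (∀ R ∈ Set.Ioo (-δ') δ', (R : ℂ) * deriv u R = a₁₁ R * u R + a₁₂ R * c R + b₁ R ∧ deriv c R = a₂₁ R * u R + a₂₂ R * c R + b₂ R) → (∀ R ∈ Set.Ioo (-δ') δ', (R : ℂ) * deriv u' R = a₁₁ R * u' R + a₁₂ R * c' R + b₁ R ∧ deriv c' R = a₂₁ R * u' R + a₂₂ R * c' R + b₂ R) → c 0 = c' 0 → ∃ δ'' : ℝ, 0 < δ'' ∧ δ'' ≤ δ' ∧ ∀ R ∈ Set.Ioo (-δ'') δ'', u R = u' R ∧ c R = c' R := by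
  intro M a₁₁ a₁₂ a₂₁ a₂₂ ha₁₁ ha₁₂ ha₂₁ ha₂₂ hre hnr b₁ b₂ hb₁ hb₂ u u' c c' δ' hδ' hu hc hu' hc' hsol hsol' hc0
  have hsm : ∀ {a : ℝ → ℂ}, ContDiff ℝ ∞ a → ContDiff ℝ ∞ (fun R => a R • ContinuousLinearMap.id ℂ ℂ) :=
    fun ha => ha.smul contDiff_const
  have key := res_branch_unique_offjets M ℂ a₁₁ (fun R => a₁₂ R • ContinuousLinearMap.id ℂ ℂ)
    (fun R => a₂₁ R • ContinuousLinearMap.id ℂ ℂ) (fun R => a₂₂ R • ContinuousLinearMap.id ℂ ℂ) ha₁₁ (hsm ha₁₂) (hsm ha₂₁)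
    (hsm ha₂₂) hre hnr b₁ b₂ hb₁ hb₂ u u' c c' δ' hδ' hu hc hu' hc'
  simp only [FunLike.coe_smul, Pi.smul_apply, ContinuousLinearMap.id_apply, smul_eq_mul] at key
  exact key hsol hsol' hc0

end Summit.AtomisticToContinuum.HydrodynamicLimit.Theorems.SonicCavityRenewal

end
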